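import Summits.CriticalPhenomena.PercolationContinuityZ3.Theorems.Transplant.FKConnectivityAllQArborealDoubleConeTransfer
import Summits.CriticalPhenomena.PercolationContinuityZ3.Theorems.Transplant.FKConnectivityAllQClusterAssocCex
import HarnessLib

/-!
# Connectivity correlation inequalities — forest-CA (`ArborealClusterAssocPos`) FAILS: the tree of a vertex under the UNIFORM random
# spanning-forest measure of the double cone `K_{2,74}` is not positively associated (exact transfer computation, no enumeration)

Support file (`--supports stmt-CriticalPhenomena-4575`), census seat `prim-bschramm-census` (gen 21) of the post-continuity
programme; builds on p205010 (kernel theorem, internal audit signed; external expert review pending).  Definitions: the rational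
transfer recursion `ZMf`/`Nf` and the witness sets on `Fin 76` (certificate data); no named facts, no sorries; standard axioms
(`decide`, no `native_decide`).

FINDING (census gens 20–21; CENSUS.md §14 item 4(c), §15; memo bschramm/FROM-census-g21-CA-REFUTED.md).  fk-1 g9's node forest-CA —
"the law of the tree `T_x` of a vertex under the arboreal gas (weighted spanning forests) is positively associated on every finite
weighted graph" — is FALSE, and like CA (`…AllQClusterAssocCex.lean`) only on large graphs: on `K_{2,m}` with all `2m` pairs of
parameter `p` the principal up-sets `{S ⊇ R ∪ {v}}`, `{S ⊇ R' ∪ {v}}` (`R ⊔ R'` the leaves) first violate it at `m = 73` for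
`p = 1/2` (the UNIFORM measure on the forests of `K_{2,m}`), `m = 65` for `p = 1/3`; nothing on `≤ 8` vertices in any census.
WITNESS: `|V| = 76`, `m = 74`, `|R| = |R'| = 37`, `p = 1/2`: `μ(𝒰)μ(𝒱) − μ(𝒰 ∩ 𝒱) = 1.45·10⁻¹⁶ > 0`.

THE PROOF repeats the transfer computation of `…AllQClusterAssocCex.lean` for the arboreal gas: with the one-leaf identity `leaf_elim`
of `…AllQArborealDoubleConeTransfer.lean` (a leaf is absent / pendant / carries both pairs, the last allowed iff `u ↮ v`),
`Z(L∪ℓ) = Z(L) − p²M(L)` (there), `M(L∪ℓ) = (1−2p²)M(L) + p²Z(L)` (`M_insert`), `N(R∪ℓ, L∪ℓ) = N(R, L∪ℓ) − (1−p)²N(R, L)` (`N_insert`),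
so `Z, M, N` depend only on `|L|, |R|` (`ZMf_eq`, `Nf_eq`) and equal the rational recursion `ZMf`/`Nf` (inclusion–exclusion form, Pascal
`Nf_succ`); almost surely `{T_u ⊇ R ∪ {v}} = {u ↔ v} ∩ ⋂_{ℓ∈R}(J_{uℓ} ∪ J_{ℓv})` (`clusterIn_iff_ev`); `decide` (kernel):
`N(74,74)·Z(74) < N(37,74)²`.
* `FK.ArborealClusterAssocCex.not_arborealClusterAssocOn_fin76 : ¬ ArborealClusterAssocOn (Fin 76)`;
* **`FK.not_arborealClusterAssocPos : ¬ ArborealClusterAssocPos`** — with `FK.not_arborealClusterDomAdjPos` (census gen 20) both forest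
  nodes of fk-1 g9 are refuted in the kernel; ALR's Conjecture 7.1 (the forest HUB inequality, `ArborealHubPos`) is NOT touched
  (clean in every census; holds on every double cone by the closed form).
[cite: Grimmett2006, §1.5 eq. (1.22) (p. 13); Thm. (3.7) (p. 39); §3.9 (p. 63)] [cite: AyyerLinussonRavichandran2025, §1 p. 3; §7 Conj. 7.1 (p. 22)]
-/

noncomputable section

namespace Summit.CriticalPhenomena.PercolationContinuityZ3.Theorems

namespace FK

open MeasureTheory Set Literature.Probability.LatticeModels Literature.Probability.Percolation
open Literature.Probability.Percolation.DecisionTree (ind ind_of_mem ind_of_not_mem)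
open scoped Classical symmDiff

namespace ArborealClusterAssocCex

open DoubleCone ArborealDoubleCone

/-! ### The certificate data: the rational transfer recursion -/

/-- `(Z_l, M_l)` for the arboreal gas of the double cone with `l` leaves: `(Z, M) ↦ (Z − p²M, (1 − 2p²)M + p²Z)`, `(Z_0, M_0) = (1, 0)`.
[cite: Grimmett2006, §1.5 eq. (1.22) (p. 13)] -/
def ZMf (p : ℚ) : ℕ → ℚ × ℚ
  | 0 => (1, 0)
  | l + 1 =>
    let z := ZMf p l
    (z.1 - p ^ 2 * z.2, (1 - 2 * p ^ 2) * z.2 + p ^ 2 * z.1)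

/-- `N(r, l) = ∑_t (−1)^t C(r,t) (1−p)^{2t} M_{l−t}` (inclusion–exclusion form). [cite: Grimmett2006, §1.5 eq. (1.22) (p. 13)] -/
def Nf (p : ℚ) (r l : ℕ) : ℚ :=
  ∑ t ∈ Finset.range (r + 1), (-1) ^ t * (r.choose t : ℚ) * ((1 - p) ^ 2) ^ t * (ZMf p (l - t)).2

/-- `N(0, l) = M_l`. [folklore] -/
theorem Nf_zero (p : ℚ) (l : ℕ) : Nf p 0 l = (ZMf p l).2 := by
  simp [Nf]

/-- Pascal's rule: `N(r+1, l) = N(r, l) − (1−p)² N(r, l−1)`. [folklore] -/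
theorem Nf_succ (p : ℚ) (r l : ℕ) : Nf p (r + 1) l = Nf p r l - (1 - p) ^ 2 * Nf p r (l - 1) := by
  set c : ℚ := (1 - p) ^ 2 with hc
  set f : ℕ → ℚ := fun t => (-1) ^ t * c ^ t * (ZMf p (l - t)).2 with hf
  have hN : ∀ r' l', Nf p r' l' = ∑ t ∈ Finset.range (r' + 1), (r'.choose t : ℚ) * ((-1) ^ t * c ^ t * (ZMf p (l' - t)).2) := by
    intro r' l'; unfold Nf; exact Finset.sum_congr rfl fun t _ => by ring
  have h1 : Nf p (r + 1) l = f 0 + ∑ t ∈ Finset.range (r + 1), ((r + 1).choose (t + 1) : ℚ) * f (t + 1) := by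
    rw [hN, Finset.sum_range_succ' _ (r + 1)]
    simp only [Nat.choose_zero_right, Nat.cast_one, one_mul, hf]
    ring
  have h2 : ∑ t ∈ Finset.range (r + 1), ((r + 1).choose (t + 1) : ℚ) * f (t + 1) =
      ∑ t ∈ Finset.range (r + 1), (r.choose t : ℚ) * f (t + 1) +
        ∑ t ∈ Finset.range (r + 1), (r.choose (t + 1) : ℚ) * f (t + 1) := by
    rw [← Finset.sum_add_distrib]
    refine Finset.sum_congr rfl fun t _ => ?_
    rw [Nat.choose_succ_succ', Nat.cast_add]; ring
  have h3 : f 0 + ∑ t ∈ Finset.range (r + 1), (r.choose (t + 1) : ℚ) * f (t + 1) = Nf p r l := by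
    have h4 : ∑ t ∈ Finset.range (r + 2), (r.choose t : ℚ) * f t = Nf p r l := by
      rw [Finset.sum_range_succ, Nat.choose_succ_self, Nat.cast_zero, zero_mul, add_zero, hN]
    rw [← h4, Finset.sum_range_succ' _ (r + 1)]
    simp only [Nat.choose_zero_right, Nat.cast_one, one_mul]
    ring
  have h5 : ∑ t ∈ Finset.range (r + 1), (r.choose t : ℚ) * f (t + 1) = -(c * Nf p r (l - 1)) := by
    rw [hN, Finset.mul_sum, ← Finset.sum_neg_distrib]
    refine Finset.sum_congr rfl fun t _ => ?_
    have hl : l - (t + 1) = l - 1 - t := by omega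
    simp only [hf, hl, pow_succ]
    ring
  rw [h1, h2, ← add_assoc, add_right_comm, h3, h5]
  ring

/-- THE NUMERICAL CERTIFICATE (`p = 1/2`, `76` vertices, `74` leaves, `|R| = |R'| = 37`): `N(74,74)·Z(74) < N(37,74)²`.
[cite: Grimmett2006, §1.5 eq. (1.22) (p. 13)] -/
theorem certificate : Nf (1 / 2) 74 74 * (ZMf (1 / 2) 74).1 < Nf (1 / 2) 37 74 * Nf (1 / 2) 37 74 := by
  decide +kernel

/-! ### The remaining transfer identities -/

variable {V : Type*} [Fintype V]

section Step

variable {u v : V} {p : unitInterval} {L : Finset V} {ℓ : V}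
variable (hL : ∀ ℓ' ∈ L, ℓ' ≠ u ∧ ℓ' ≠ v) (huv : u ≠ v) (hℓu : ℓ ≠ u) (hℓv : ℓ ≠ v) (hℓ : ℓ ∉ L)
include hL huv hℓu hℓv hℓ

/-- `M(L ∪ {ℓ}) = (1 − 2p²)·M(L) + p²·Z(L)`. [cite: Grimmett2006, §1.5 eq. (1.22) (p. 13); Thm. (3.7) (p. 39)] -/
theorem M_insert :
    ∑ ω : BondConfig V, agWeight (wK u v p (insert ℓ L)) ω * ind (openConn u v : Set (BondConfig V)) ω =
      (1 - 2 * ((p : ℝ) * (p : ℝ))) *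
          ∑ ω : BondConfig V, agWeight (wK u v p L) ω * ind (openConn u v : Set (BondConfig V)) ω +
        (p : ℝ) * (p : ℝ) * agPartition (wK u v p L) := by
  have hab : s(u, ℓ) ≠ s(ℓ, v) := apex_pairs_ne hℓu huv
  have hiso : ∀ ω, agWeight (wK u v p L) ω ≠ 0 → ∀ e ∈ ω, ℓ ∉ e := fun ω hω =>
    isolated_of_not_mem u v p hL huv hℓu hℓv hℓ hω
  have key := leaf_elim (p := p) hL huv hℓu hℓv hℓ (openConn u v : Set (BondConfig V))
  rw [key]
  have e1 : ∑ ω : BondConfig V, agWeight (wK u v p L) ω * ind (openConn u v : Set (BondConfig V)) (insert s(ℓ, v) ω) =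
      ∑ ω : BondConfig V, agWeight (wK u v p L) ω * ind (openConn u v : Set (BondConfig V)) ω := by
    refine sum_congr_ae (wK u v p L) fun ω hω => ?_
    have h := reachable_union_apex hℓu hℓv (hiso ω hω) (τ := {s(ℓ, v)}) (by
      intro e he; rw [Set.mem_singleton_iff.1 he]; simp)
    rw [Set.singleton_union] at h
    have hiff : insert s(ℓ, v) ω ∈ (openConn u v : Set (BondConfig V)) ↔ ω ∈ (openConn u v : Set (BondConfig V)) := by
      rw [mem_openConn_iff', mem_openConn_iff', h]
      simp [hab]
    by_cases hm : ω ∈ (openConn u v : Set (BondConfig V))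
    · rw [ind_of_mem hm, ind_of_mem (hiff.2 hm)]
    · rw [ind_of_not_mem hm, ind_of_not_mem (fun h' => hm (hiff.1 h'))]
  have e2 : ∑ ω : BondConfig V, agWeight (wK u v p L) ω * ind (openConn u v : Set (BondConfig V)) (insert s(u, ℓ) ω) =
      ∑ ω : BondConfig V, agWeight (wK u v p L) ω * ind (openConn u v : Set (BondConfig V)) ω := by
    refine sum_congr_ae (wK u v p L) fun ω hω => ?_
    have h := reachable_union_apex hℓu hℓv (hiso ω hω) (τ := {s(u, ℓ)}) (by
      intro e he; rw [Set.mem_singleton_iff.1 he]; simp)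
    rw [Set.singleton_union] at h
    have hiff : insert s(u, ℓ) ω ∈ (openConn u v : Set (BondConfig V)) ↔ ω ∈ (openConn u v : Set (BondConfig V)) := by
      rw [mem_openConn_iff', mem_openConn_iff', h]
      simp [hab.symm]
    by_cases hm : ω ∈ (openConn u v : Set (BondConfig V))
    · rw [ind_of_mem hm, ind_of_mem (hiff.2 hm)]
    · rw [ind_of_not_mem hm, ind_of_not_mem (fun h' => hm (hiff.1 h'))]
  have e3 : ∑ ω : BondConfig V, agWeight (wK u v p L) ω *
      (ind (openConn u v : Set (BondConfig V))ᶜ ω * ind (openConn u v : Set (BondConfig V)) (insert s(u, ℓ) (insert s(ℓ, v) ω))) =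
      ∑ ω : BondConfig V, agWeight (wK u v p L) ω * ind (openConn u v : Set (BondConfig V))ᶜ ω := by
    refine sum_congr_ae (wK u v p L) fun ω hω => ?_
    have h := reachable_union_apex hℓu hℓv (hiso ω hω) (τ := {s(u, ℓ), s(ℓ, v)}) subset_rfl
    have hins : ({s(u, ℓ), s(ℓ, v)} : Set (Sym2 V)) ∪ ω = insert s(u, ℓ) (insert s(ℓ, v) ω) := by
      rw [Set.insert_union, Set.singleton_union]
    rw [hins] at h
    have hm : insert s(u, ℓ) (insert s(ℓ, v) ω) ∈ (openConn u v : Set (BondConfig V)) := by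
      rw [mem_openConn_iff', h]; exact Or.inr ⟨by simp, by simp⟩
    rw [ind_of_mem hm, mul_one]
  rw [e1, e2, e3, ArborealDoubleCone.sum_ind_compl]
  ring

/-- The leaf recursion for the events: `N(R ∪ {ℓ}, L ∪ {ℓ}) = N(R, L ∪ {ℓ}) − (1−p)²·N(R, L)`.
[cite: Grimmett2006, §1.5 eq. (1.22) (p. 13); Thm. (3.7) (p. 39)] -/
theorem N_insert (R : Finset V) :
    ∑ ω : BondConfig V, agWeight (wK u v p (insert ℓ L)) ω * ind (ev u v (insert ℓ R)) ω =
      ∑ ω : BondConfig V, agWeight (wK u v p (insert ℓ L)) ω * ind (ev u v R) ω -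
        (1 - (p : ℝ)) * (1 - (p : ℝ)) * ∑ ω : BondConfig V, agWeight (wK u v p L) ω * ind (ev u v R) ω := by
  set w := wK u v p (insert ℓ L) with hw
  have hwa : ((w s(u, ℓ) : unitInterval) : ℝ) = p := wK_apply_left u v p (Finset.mem_insert_self ℓ L)
  have hwb : ((w s(ℓ, v) : unitInterval) : ℝ) = p := wK_apply_right u v p (Finset.mem_insert_self ℓ L)
  have hab : s(u, ℓ) ≠ s(ℓ, v) := apex_pairs_ne hℓu huv
  have hup := wK_insert_update u v p hL huv hℓu hℓv hℓ
  have hw₁b : ((Function.update w s(u, ℓ) 0 s(ℓ, v) : unitInterval) : ℝ) = p := by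
    rw [Function.update_of_ne hab.symm, hwb]
  -- pointwise: `1_{ev(R ∪ ℓ)} = 1_{ev R} − 1{a ∉ ω}·1{b ∉ ω}·1_{ev R}`
  have hpt : ∀ ω : BondConfig V, ind (ev u v (insert ℓ R)) ω =
      ind (ev u v R) ω - ind {ω : BondConfig V | s(u, ℓ) ∈ ω}ᶜ ω * (ind {ω : BondConfig V | s(ℓ, v) ∈ ω}ᶜ ω * ind (ev u v R) ω) := by
    intro ω
    have hev : ω ∈ ev u v (insert ℓ R) ↔ ω ∈ ev u v R ∧ (s(u, ℓ) ∈ ω ∨ s(ℓ, v) ∈ ω) := by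
      simp only [ev, Set.mem_inter_iff, Set.mem_setOf_eq, Finset.forall_mem_insert]
      tauto
    by_cases hE : ω ∈ ev u v R
    · by_cases ha : s(u, ℓ) ∈ ω
      · rw [ind_of_mem (hev.2 ⟨hE, Or.inl ha⟩), ind_of_mem hE,
          ind_of_not_mem (X := {ω : BondConfig V | s(u, ℓ) ∈ ω}ᶜ) (fun h => h ha)]; ring
      · by_cases hb : s(ℓ, v) ∈ ω
        · rw [ind_of_mem (hev.2 ⟨hE, Or.inr hb⟩), ind_of_mem hE,
            ind_of_not_mem (X := {ω : BondConfig V | s(ℓ, v) ∈ ω}ᶜ) (fun h => h hb)]; ring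
        · rw [ind_of_not_mem (fun h => ((hev.1 h).2.elim ha hb)), ind_of_mem hE,
            ind_of_mem (X := {ω : BondConfig V | s(u, ℓ) ∈ ω}ᶜ) ha, ind_of_mem (X := {ω : BondConfig V | s(ℓ, v) ∈ ω}ᶜ) hb]; ring
    · rw [ind_of_not_mem (fun h => hE (hev.1 h).1), ind_of_not_mem hE]; ring
  have hsum : ∑ ω : BondConfig V, agWeight w ω * ind (ev u v (insert ℓ R)) ω =
      ∑ ω : BondConfig V, agWeight w ω * ind (ev u v R) ω -
        ∑ ω : BondConfig V, agWeight w ω *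
          (ind {ω : BondConfig V | s(u, ℓ) ∈ ω}ᶜ ω * (ind {ω : BondConfig V | s(ℓ, v) ∈ ω}ᶜ ω * ind (ev u v R) ω)) := by
    rw [← Finset.sum_sub_distrib]
    exact Finset.sum_congr rfl fun ω _ => by rw [hpt]; ring
  rw [hsum, sum_closed w s(u, ℓ), hwa, sum_closed _ s(ℓ, v), hw₁b, hup]
  ring

end Step

/-! ### The masses as functions of the cardinalities -/

section Values

variable (u v : V) (p : unitInterval) (pq : ℚ)

/-- `Z(L) = Z_{|L|}` and `M(L) = M_{|L|}`. [cite: Grimmett2006, §1.5 eq. (1.22) (p. 13)] -/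
theorem ZMf_eq (hpq : ((p : unitInterval) : ℝ) = (pq : ℝ)) (huv : u ≠ v) :
    ∀ L : Finset V, (∀ ℓ ∈ L, ℓ ≠ u ∧ ℓ ≠ v) →
      agPartition (wK u v p L) = ((ZMf pq L.card).1 : ℝ) ∧
        ∑ ω : BondConfig V, agWeight (wK u v p L) ω * ind (openConn u v : Set (BondConfig V)) ω = ((ZMf pq L.card).2 : ℝ) := by
  intro L
  induction L using Finset.induction_on with
  | empty =>
    intro _
    rw [Finset.card_empty, ArborealDoubleCone.Z_empty, ArborealDoubleCone.M_empty u v p huv]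
    simp [ZMf]
  | @insert ℓ L hℓ ih =>
    intro hL
    have hL' : ∀ ℓ' ∈ L, ℓ' ≠ u ∧ ℓ' ≠ v := fun ℓ' h => hL ℓ' (Finset.mem_insert_of_mem h)
    have hℓuv := hL ℓ (Finset.mem_insert_self ℓ L)
    obtain ⟨ihZ, ihM⟩ := ih hL'
    rw [Finset.card_insert_of_notMem hℓ, ArborealDoubleCone.Z_insert hL' huv hℓuv.1 hℓuv.2 hℓ,
      M_insert hL' huv hℓuv.1 hℓuv.2 hℓ, ihZ, ihM, hpq]
    simp only [ZMf]
    push_cast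
    constructor <;> ring

/-- `N(R, L) = N_{|R|,|L|}` for `R ⊆ L`. [cite: Grimmett2006, §1.5 eq. (1.22) (p. 13)] -/
theorem Nf_eq (hpq : ((p : unitInterval) : ℝ) = (pq : ℝ)) (huv : u ≠ v) :
    ∀ R L : Finset V, (∀ ℓ ∈ L, ℓ ≠ u ∧ ℓ ≠ v) → R ⊆ L →
      ∑ ω : BondConfig V, agWeight (wK u v p L) ω * ind (ev u v R) ω = ((Nf pq R.card L.card : ℚ) : ℝ) := by
  intro R
  induction R using Finset.induction_on with
  | empty =>
    intro L hL _
    have hev : ev u v (∅ : Finset V) = (openConn u v : Set (BondConfig V)) := by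
      ext ω; simp [ev]
    rw [hev, (ZMf_eq u v p pq hpq huv L hL).2, Finset.card_empty, Nf_zero]
  | @insert ℓ R hℓR ih =>
    intro L hL hRL
    have hℓL : ℓ ∈ L := hRL (Finset.mem_insert_self ℓ R)
    have hℓuv := hL ℓ hℓL
    set L' := L.erase ℓ with hL'def
    have hLeq : L = insert ℓ L' := (Finset.insert_erase hℓL).symm
    have hℓL' : ℓ ∉ L' := Finset.notMem_erase ℓ L
    have hL'h : ∀ ℓ' ∈ L', ℓ' ≠ u ∧ ℓ' ≠ v := fun ℓ' h => hL ℓ' (Finset.mem_of_mem_erase h)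
    have hRL' : R ⊆ L' := by
      intro x hx
      exact Finset.mem_erase.2 ⟨fun h => hℓR (h ▸ hx), hRL (Finset.mem_insert_of_mem hx)⟩
    have hcard : L.card = L'.card + 1 := by rw [hLeq, Finset.card_insert_of_notMem hℓL']
    rw [hLeq, N_insert hL'h huv hℓuv.1 hℓuv.2 hℓL' R, ← hLeq, ih L hL (hRL'.trans (Finset.erase_subset ℓ L)),
      ih L' hL'h hRL', Finset.card_insert_of_notMem hℓR, hcard, Nf_succ, Nat.add_sub_cancel, hpq]
    push_cast
    ring

end Values

/-! ### The tree event almost surely -/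

/-- Almost surely under the arboreal gas of `K_{2,L}`: `T_u ⊇ R ∪ {v}` iff `u ↔ v` and every leaf of `R ⊆ L` carries a pair.
[cite: Grimmett2006, §1.5 eq. (1.22) (p. 13)] -/
theorem clusterIn_iff_ev (u v : V) (p : unitInterval) {L R : Finset V} (hL : ∀ ℓ ∈ L, ℓ ≠ u ∧ ℓ ≠ v) (hRL : R ⊆ L)
    {ω : BondConfig V} (hω : agWeight (wK u v p L) ω ≠ 0) :
    ω ∈ clusterIn u {S : Set V | v ∈ S ∧ ∀ ℓ ∈ R, ℓ ∈ S} ↔ ω ∈ ev u v R := by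
  have hapex : ∀ ℓ ∈ L, ∀ e ∈ ω, ℓ ∈ e → e = s(u, ℓ) ∨ e = s(ℓ, v) := fun ℓ hℓ =>
    ArborealDoubleCone.apex_of_ne_zero u v p (hL ℓ hℓ).1 (hL ℓ hℓ).2 hω
  change (v ∈ openCluster ω u ∧ ∀ ℓ ∈ R, ℓ ∈ openCluster ω u) ↔
    ω ∈ (openConn u v : Set (BondConfig V)) ∧ ∀ ℓ ∈ R, s(u, ℓ) ∈ ω ∨ s(ℓ, v) ∈ ω
  rw [mem_openConn_iff']
  constructor
  · rintro ⟨huv', hR⟩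
    refine ⟨huv', fun ℓ hℓ => ?_⟩
    have hr : (openGraph ω).Reachable u ℓ := hR ℓ hℓ
    rw [reachable_ux_apex_iff (hL ℓ (hRL hℓ)).1 (hL ℓ (hRL hℓ)).2 (hapex ℓ (hRL hℓ))] at hr
    rcases hr with h | ⟨h, -⟩
    · exact Or.inl h
    · exact Or.inr h
  · rintro ⟨huv', hR⟩
    refine ⟨huv', fun ℓ hℓ => ?_⟩
    rcases hR ℓ hℓ with h | h
    · have hadj : (openGraph ω).Adj u ℓ := by rw [openGraph_adj]; exact ⟨h, (hL ℓ (hRL hℓ)).1.symm⟩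
      exact hadj.reachable
    · have hadj : (openGraph ω).Adj v ℓ := by
        rw [openGraph_adj, Sym2.eq_swap]; exact ⟨h, (hL ℓ (hRL hℓ)).2.symm⟩
      exact huv'.trans hadj.reachable

/-! ### The witness `K_{2,74} ⊆ Fin 76`, uniform forests -/

/-- The parameter `1/2` (uniform spanning forests). [folklore] -/
def pHalf : unitInterval := ⟨1 / 2, by norm_num, by norm_num⟩

/-- The leaves `2, …, 75`. [folklore] -/
def leaves : Finset (Fin 76) := Finset.univ.filter fun i => 2 ≤ i.val

/-- `R = {2, …, 38}`. [folklore] -/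
def halfR : Finset (Fin 76) := Finset.univ.filter fun i => 2 ≤ i.val ∧ i.val ≤ 38

/-- `R' = {39, …, 75}`. [folklore] -/
def halfR' : Finset (Fin 76) := Finset.univ.filter fun i => 39 ≤ i.val

/-- **forest-CA fails on `Fin 76`**: uniform forests of the double cone `K_{2,74}`, root the hub `0`, principal up-sets of
`{1} ∪ {2..38}` and `{1} ∪ {39..75}`. [cite: AyyerLinussonRavichandran2025, §7 Conj. 7.1 (p. 22)] [cite: Grimmett2006, §1.5 (p. 13)] -/
theorem not_arborealClusterAssocOn_fin76 : ¬ ArborealClusterAssocOn (Fin 76) := by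
  intro h
  have hpq : ((pHalf : unitInterval) : ℝ) = ((1 / 2 : ℚ) : ℝ) := by simp [pHalf]
  have huv : (0 : Fin 76) ≠ 1 := by decide
  have hL : ∀ ℓ ∈ leaves, ℓ ≠ (0 : Fin 76) ∧ ℓ ≠ 1 := by decide
  have hR : halfR ⊆ leaves := by decide
  have hR' : halfR' ⊆ leaves := by decide
  have hRR' : halfR ∪ halfR' = leaves := by decide
  have hcL : leaves.card = 74 := by decide
  have hcR : halfR.card = 37 := by decide
  have hcR' : halfR'.card = 37 := by decide
  set w := wK (0 : Fin 76) 1 pHalf leaves with hw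
  have key := h w 0 _ _ (ClusterAssocCex.isUpperSet_principal (1 : Fin 76) halfR)
    (ClusterAssocCex.isUpperSet_principal (1 : Fin 76) halfR')
  have hZv : agPartition w = ((ZMf (1 / 2) 74).1 : ℝ) := by
    rw [(ZMf_eq 0 1 pHalf (1 / 2) hpq huv leaves hL).1, hcL]
  have hZq : (0 : ℚ) < (ZMf (1 / 2) 74).1 := by decide +kernel
  have hZ : 0 < agPartition w := by rw [hZv]; exact_mod_cast hZq
  have huniv : (agMeasure w).real univ = 1 := by rw [agMeasure_real_univ, if_neg hZ.ne']
  have hU : (agMeasure w).real (clusterIn 0 {S : Set (Fin 76) | (1 : Fin 76) ∈ S ∧ ∀ ℓ ∈ halfR, ℓ ∈ S}) =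
      ((Nf (1 / 2) 37 74 : ℚ) : ℝ) / agPartition w := by
    rw [agMeasure_real_eq_sum_div, ArborealDoubleCone.sum_congr_ae w
      (fun ω hω => show ind _ ω = ind (ev (0 : Fin 76) 1 halfR) ω by
        by_cases hm : ω ∈ ev (0 : Fin 76) 1 halfR
        · rw [ind_of_mem hm, ind_of_mem ((clusterIn_iff_ev 0 1 pHalf hL hR hω).2 hm)]
        · rw [ind_of_not_mem hm, ind_of_not_mem (fun h' => hm ((clusterIn_iff_ev 0 1 pHalf hL hR hω).1 h'))]),
      Nf_eq 0 1 pHalf (1 / 2) hpq huv halfR leaves hL hR, hcR, hcL]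
  have hU' : (agMeasure w).real (clusterIn 0 {S : Set (Fin 76) | (1 : Fin 76) ∈ S ∧ ∀ ℓ ∈ halfR', ℓ ∈ S}) =
      ((Nf (1 / 2) 37 74 : ℚ) : ℝ) / agPartition w := by
    rw [agMeasure_real_eq_sum_div, ArborealDoubleCone.sum_congr_ae w
      (fun ω hω => show ind _ ω = ind (ev (0 : Fin 76) 1 halfR') ω by
        by_cases hm : ω ∈ ev (0 : Fin 76) 1 halfR'
        · rw [ind_of_mem hm, ind_of_mem ((clusterIn_iff_ev 0 1 pHalf hL hR' hω).2 hm)]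
        · rw [ind_of_not_mem hm, ind_of_not_mem (fun h' => hm ((clusterIn_iff_ev 0 1 pHalf hL hR' hω).1 h'))]),
      Nf_eq 0 1 pHalf (1 / 2) hpq huv halfR' leaves hL hR', hcR', hcL]
  have hinter : clusterIn (0 : Fin 76) {S : Set (Fin 76) | (1 : Fin 76) ∈ S ∧ ∀ ℓ ∈ halfR, ℓ ∈ S} ∩
      clusterIn 0 {S : Set (Fin 76) | (1 : Fin 76) ∈ S ∧ ∀ ℓ ∈ halfR', ℓ ∈ S} =
      clusterIn 0 {S : Set (Fin 76) | (1 : Fin 76) ∈ S ∧ ∀ ℓ ∈ leaves, ℓ ∈ S} := by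
    ext ω
    simp only [clusterIn, Set.mem_inter_iff, Set.mem_setOf_eq, ← hRR', Finset.mem_union]
    constructor
    · rintro ⟨⟨h1, h2⟩, ⟨-, h3⟩⟩
      exact ⟨h1, fun ℓ hℓ => hℓ.elim (h2 ℓ) (h3 ℓ)⟩
    · rintro ⟨h1, h2⟩
      exact ⟨⟨h1, fun ℓ hℓ => h2 ℓ (Or.inl hℓ)⟩, ⟨h1, fun ℓ hℓ => h2 ℓ (Or.inr hℓ)⟩⟩
  have hUV : (agMeasure w).real (clusterIn (0 : Fin 76) {S : Set (Fin 76) | (1 : Fin 76) ∈ S ∧ ∀ ℓ ∈ halfR, ℓ ∈ S} ∩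
      clusterIn 0 {S : Set (Fin 76) | (1 : Fin 76) ∈ S ∧ ∀ ℓ ∈ halfR', ℓ ∈ S}) =
      ((Nf (1 / 2) 74 74 : ℚ) : ℝ) / agPartition w := by
    rw [hinter, agMeasure_real_eq_sum_div, ArborealDoubleCone.sum_congr_ae w
      (fun ω hω => show ind _ ω = ind (ev (0 : Fin 76) 1 leaves) ω by
        by_cases hm : ω ∈ ev (0 : Fin 76) 1 leaves
        · rw [ind_of_mem hm, ind_of_mem ((clusterIn_iff_ev 0 1 pHalf hL subset_rfl hω).2 hm)]
        · rw [ind_of_not_mem hm, ind_of_not_mem (fun h' => hm ((clusterIn_iff_ev 0 1 pHalf hL subset_rfl hω).1 h'))]),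
      Nf_eq 0 1 pHalf (1 / 2) hpq huv leaves leaves hL subset_rfl, hcL]
  rw [hU, hU', hUV, huniv, one_mul, div_mul_div_comm,
    ← mul_div_mul_right (((Nf (1 / 2) 74 74 : ℚ) : ℝ)) _ hZ.ne',
    div_le_div_iff_of_pos_right (mul_pos hZ hZ), hZv] at key
  have cert' : ((Nf (1 / 2) 74 74 * (ZMf (1 / 2) 74).1 : ℚ) : ℝ) < ((Nf (1 / 2) 37 74 * Nf (1 / 2) 37 74 : ℚ) : ℝ) := by
    exact_mod_cast certificate
  push_cast at cert'
  linarith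

end ArborealClusterAssocCex

/-- **forest-CA (`ArborealClusterAssocPos`, fk-1 g9) is FALSE**: the tree of a vertex under the uniform spanning-forest measure of
`K_{2,74}` is not positively associated.  Refuted-substantive for the node as filed; ALR's Conjecture 7.1 (the forest hub inequality)
is not touched. [cite: AyyerLinussonRavichandran2025, §7 Conj. 7.1 (p. 22)] [cite: Grimmett2006, §1.5 eq. (1.22) (p. 13)] -/
theorem not_arborealClusterAssocPos : ¬ ArborealClusterAssocPos := fun h =>
  ArborealClusterAssocCex.not_arborealClusterAssocOn_fin76 (h 76)

end FK

end Summit.CriticalPhenomena.PercolationContinuityZ3.Theorems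

end
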